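import Literature.AlgebraicGeometry.HodgeTheory.HodgeIndexSurfaceSigned
import Literature.AlgebraicGeometry.Deligne1982.WeilTypeCMPeriodPointBlockRank
import Literature.LinearAlgebra.QuadraticForm.SylvesterOrthogonalSplitting
import HarnessLib

/-!
# The Hodge index theorem on the real `(1,1)`-classes of a surface: signature `(1, h^{1,1} - 1)`

Huybrechts, *Complex Geometry*, Cor. 3.3.16, second clause: for a compact Kähler surface the
intersection pairing "restricted to `H^{1,1}(X)` is of index `(1, h^{1,1}(X) - 1)`".  For `X` smooth
projective of dimension `2`, a `ℤ`-orientation `μ` of `X(ℂ)` pairing positively with the Kähler volume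
class of a Kähler–rational datum (the complex orientation), and `U = H^{1,1}_ℝ ⊆ H²(X(ℂ); ℝ)` the real
classes whose complexification is of type `(1,1)` (ANY real subspace with this membership), this file
PROVES:

* `KaehlerRationalDatum.sigPos_sigNeg_restrict_oneOne_of_pos`: the real cup pairing
  `B(x, x') = ⟨x ⌣ x', [X(ℂ)]_μ ⊗ 1⟩` restricted to `U` has `b⁺ = 1` and `b⁻ = dim_ℝ U - 1`: it is positive
  on the Kähler line `ℝ κ ⊆ U` (`κ ⌣ κ = y_Ω`) and negative definite on its orthogonal inside `U`, the
  real primitive `(1,1)`-classes (`cupProduct_conjClass_oneOne`: `u ⌣ ū = -t Ω`); the count is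
  Sylvester's law on the splitting `U = ℝκ ⊕ κ^⊥` (`sigPos_sigNeg_of_posDef_range`);
* `finrank_realOneOne_eq`: `dim_ℝ H^{1,1}_ℝ = h^{1,1} = dim_ℂ H^{1,1}` (`H^{1,1}` is defined over `ℝ`:
  `c ∈ H^{1,1} ↔ re c, im c ∈ H^{1,1}_ℝ`, and `finrank_real_eq_finrank_complex_of_forall_mem_iff`);
* `KaehlerRationalDatum.sigPos_sigNeg_restrict_oneOne_eq_hodgeNumber`: hence `(b⁺, b⁻) = (1, h^{1,1} - 1)`
  on `H^{1,1}_ℝ`, `h^{1,1}` read on any Hodge model.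

(The lane's sign-free algebraic form — index `1` on the Néron–Severi classes — is `hodgeIndex_surface`;
the count on all of `H²(X(ℂ); ℝ)`, `(2h^{2,0} + 1, h^{1,1} - 1)`, is `HodgeIndexSurfaceSigned.lean`.)

## References

* D. Huybrechts, *Complex Geometry. An Introduction*, Universitext (2005), Cor. 3.3.16, PDF p. 163 of
  the held text. [cite: Huybrechts2005, Cor. 3.3.16]
* C. Voisin, *Hodge Theory and Complex Algebraic Geometry I* (2002), §6.3.2 Thm. 6.32 and Thm. 6.33.
  [cite: VoisinHodgeI2002, §6.3.2 Thms. 6.32–6.33]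
-/

noncomputable section

open scoped Manifold ContDiff
open CategoryTheory AlgebraicGeometry Module Bundle
open Literature.AlgebraicTopology.SingularHomology Literature.Geometry.Kaehler
open Literature.NumberTheory.Transcendental
open Literature.AlgebraicGeometry.Motives (IsSmoothProjective kaehlerFormPow)

namespace Literature.AlgebraicGeometry.HodgeTheory

section Surface

variable {X : Motives.SchemeOver ℂ}

/-- **`H^{1,1}` is defined over `ℝ`**: `c ∈ H^{1,1}(X)` iff `re c ⊗ 1` and `im c ⊗ 1` are of type
`(1,1)` (`H^{1,1}` is stable under conjugation, Voisin I Cor. 6.12, and `c = re c ⊗ 1 + i (im c ⊗ 1)`,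
`2 (re c ⊗ 1) = c + c̄`, `2i (im c ⊗ 1) = c - c̄`). [cite: VoisinHodgeI2002, §6.1.3 Cor. 6.12] -/
theorem isOfHodgeType_oneOne_iff_reClass_imClass (hX : IsSmoothProjective 2 X) (c : complexBetti X 2) :
    IsOfHodgeType 2 X 2 1 1 c ↔
      IsOfHodgeType 2 X 2 1 1 (ofRealClass _ 2 (reClass _ 2 c)) ∧
        IsOfHodgeType 2 X 2 1 1 (ofRealClass _ 2 (imClass _ 2 c)) := by
  classical
  have hI := hodgePQ_independent_of_hodgeModel_holds
  obtain ⟨D⟩ := nonempty_kaehlerRationalDatum (n := 2) hX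
  -- `H^{1,1}` as a `ℂ`-submodule: the type piece `(1,1)` of the datum's model
  generalize hH : D.B.typePiece 2 ⟨(1, 1), Finset.HasAntidiagonal.mem_antidiagonal.2 rfl⟩ = H
  have hmem : ∀ σ : complexBetti X 2, σ ∈ H ↔ IsOfHodgeType 2 X 2 1 1 σ := by
    intro σ
    rw [← hH]
    constructor
    · intro hσ
      have h := D.B.isOfHodgeType_of_mem_typePiece hσ
      exact h
    · intro hσ
      exact D.B.mem_typePiece_of_isOfHodgeType hI hX _ hσ
  have hsum := ofRealClass_reClass_add_I_smul c
  have hconj := conjClass_eq_reClass_sub_imClass c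
  constructor
  · intro hc
    have hcm : c ∈ H := (hmem c).2 hc
    have hcbar : conjClass _ 2 c ∈ H := (hmem _).2 (hc.conjClass hX)
    have h2 : (2 : ℂ) • ofRealClass _ 2 (reClass _ 2 c) = c + conjClass _ 2 c :=
      calc (2 : ℂ) • ofRealClass _ 2 (reClass _ 2 c)
          = (ofRealClass _ 2 (reClass _ 2 c) + Complex.I • ofRealClass _ 2 (imClass _ 2 c)) +
              (ofRealClass _ 2 (reClass _ 2 c) - Complex.I • ofRealClass _ 2 (imClass _ 2 c)) := by
            rw [two_smul]; abel
        _ = c + conjClass _ 2 c := by rw [hsum, ← hconj]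
    have h3 : (2 * Complex.I) • ofRealClass _ 2 (imClass _ 2 c) = c - conjClass _ 2 c :=
      calc (2 * Complex.I) • ofRealClass _ 2 (imClass _ 2 c)
          = (ofRealClass _ 2 (reClass _ 2 c) + Complex.I • ofRealClass _ 2 (imClass _ 2 c)) -
              (ofRealClass _ 2 (reClass _ 2 c) - Complex.I • ofRealClass _ 2 (imClass _ 2 c)) := by
            rw [mul_smul, two_smul]; abel
        _ = c - conjClass _ 2 c := by rw [hsum, ← hconj]
    have hre : ofRealClass _ 2 (reClass _ 2 c) = (2⁻¹ : ℂ) • (c + conjClass _ 2 c) := by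
      rw [← h2, smul_smul, inv_mul_cancel₀ two_ne_zero, one_smul]
    have him : ofRealClass _ 2 (imClass _ 2 c) = (2 * Complex.I)⁻¹ • (c - conjClass _ 2 c) := by
      rw [← h3, smul_smul, inv_mul_cancel₀ (mul_ne_zero two_ne_zero Complex.I_ne_zero), one_smul]
    refine ⟨(hmem _).1 ?_, (hmem _).1 ?_⟩
    · rw [hre]; exact H.smul_mem _ (H.add_mem hcm hcbar)
    · rw [him]; exact H.smul_mem _ (H.sub_mem hcm hcbar)
  · rintro ⟨hre, him⟩
    have h : c ∈ H := by
      rw [← hsum]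
      exact H.add_mem ((hmem _).2 hre) (H.smul_mem _ ((hmem _).2 him))
    exact (hmem c).1 h

/-- **`dim_ℝ H^{1,1}_ℝ = h^{1,1}`**: a real subspace `U ⊆ H²(X(ℂ); ℝ)` consisting exactly of the classes
whose complexification is of type `(1,1)` has real dimension `dim_ℂ` of the type piece `(1,1)` (of any
Hodge model). [cite: VoisinHodgeI2002, §6.1.3 Cor. 6.12 and §7.1.1] -/
theorem finrank_realOneOne_eq (hX : IsSmoothProjective 2 X) (U : Submodule ℝ (singularCohomology ℝ ℝ (Motives.ComplexPoints X) 2))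
    (hU : ∀ y, y ∈ U ↔ IsOfHodgeType 2 X 2 1 1 (ofRealClass _ 2 y)) (A : HodgeModel 2 X) :
    Module.finrank ℝ U =
      Module.finrank ℂ (A.typePiece 2 ⟨(1, 1), Finset.HasAntidiagonal.mem_antidiagonal.2 rfl⟩) := by
  classical
  have hI := hodgePQ_independent_of_hodgeModel_holds
  letI := hX.chartedSpace
  haveI := Motives.ComplexPoints.compactSpace_of_isSmoothProjective hX
  haveI := Motives.ComplexPoints.t2Space_of_isSmoothProjective hX
  haveI : Module.Finite ℝ (singularCohomology ℝ ℝ (Motives.ComplexPoints X) 2) :=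
    finite_singularCohomology_of_compact_chartedSpace ℝ ℝ (d := 2 * 2) 2
  generalize hH : A.typePiece 2 ⟨(1, 1), Finset.HasAntidiagonal.mem_antidiagonal.2 rfl⟩ = H
  have hmem : ∀ σ : complexBetti X 2, σ ∈ H ↔ IsOfHodgeType 2 X 2 1 1 σ := by
    intro σ
    rw [← hH]
    constructor
    · intro hσ
      have h := A.isOfHodgeType_of_mem_typePiece hσ
      exact h
    · intro hσ
      exact A.mem_typePiece_of_isOfHodgeType hI hX _ hσ
  refine Deligne1982.finrank_real_eq_finrank_complex_of_forall_mem_iff U H (fun c ↦ ?_)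
  rw [hmem, hU, hU]
  exact isOfHodgeType_oneOne_iff_reClass_imClass hX c

namespace KaehlerRationalDatum

variable (D : KaehlerRationalDatum 2 X)

/-- **The Hodge index theorem on `H^{1,1}_ℝ`, with sign** (Huybrechts Cor. 3.3.16, second clause:
"restricted to `H^{1,1}(X)` it is of index `(1, h^{1,1}(X) - 1)`"): for `μ` pairing positively with
the Kähler volume class `Ω` of the datum and `U = H^{1,1}_ℝ` (the real classes of type `(1,1)`), the
restriction of `B(x, x') = ⟨x ⌣ x', [X(ℂ)]_μ ⊗ 1⟩` to `U` has `b⁺ = 1`, `b⁻ = dim_ℝ U - 1`: positive on the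
Kähler line `ℝκ` (`κ ⌣ κ = y_Ω`), negative definite on `κ^⊥ ∩ U`, the real primitive `(1,1)`-classes
(`u ⌣ ū = -t Ω`, Thm. 6.32). [cite: Huybrechts2005, Cor. 3.3.16] [cite: VoisinHodgeI2002, §6.3.2 Thm. 6.32] -/
theorem sigPos_sigNeg_restrict_oneOne_of_pos (hX : IsSmoothProjective 2 X)
    (μ : HomologicalOrientation ℤ (Motives.ComplexPoints X) (2 * 2)) (h22 : 2 + 2 = 2 * 2)
    (hP : 0 < kroneckerPairing ℝ ℝ (Motives.ComplexPoints X) (2 * 2) (reClass _ (2 * 2) D.topClass)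
      (singularHomology.coeffChange (Motives.ComplexPoints X)
        (algebraMap ℤ ℝ : ℤ →+* ℝ).toAddMonoidHom (2 * 2) μ.fundamentalClass))
    (U : Submodule ℝ (singularCohomology ℝ ℝ (Motives.ComplexPoints X) 2))
    (hU : ∀ y, y ∈ U ↔ IsOfHodgeType 2 X 2 1 1 (ofRealClass _ 2 y)) :
    sigPos ((LinearMap.BilinMap.toQuadraticMap
        ((cupProduct (R := ℝ) (X := Motives.ComplexPoints X) h22).compr₂
          ((kroneckerPairing ℝ ℝ (Motives.ComplexPoints X) (2 * 2)).flip
            (singularHomology.coeffChange (Motives.ComplexPoints X)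
              (algebraMap ℤ ℝ : ℤ →+* ℝ).toAddMonoidHom (2 * 2) μ.fundamentalClass)))).restrict U) = 1 ∧
      sigNeg ((LinearMap.BilinMap.toQuadraticMap
        ((cupProduct (R := ℝ) (X := Motives.ComplexPoints X) h22).compr₂
          ((kroneckerPairing ℝ ℝ (Motives.ComplexPoints X) (2 * 2)).flip
            (singularHomology.coeffChange (Motives.ComplexPoints X)
              (algebraMap ℤ ℝ : ℤ →+* ℝ).toAddMonoidHom (2 * 2) μ.fundamentalClass)))).restrict U) + 1 =
        Module.finrank ℝ U := by
  classical
  letI := hX.chartedSpace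
  haveI := Motives.ComplexPoints.compactSpace_of_isSmoothProjective hX
  haveI := Motives.ComplexPoints.t2Space_of_isSmoothProjective hX
  haveI := connectedSpace_complexPoints hX
  haveI : Module.Finite ℝ (singularCohomology ℝ ℝ (Motives.ComplexPoints X) 2) :=
    finite_singularCohomology_of_compact_chartedSpace ℝ ℝ (d := 2 * 2) 2
  -- notation
  set FX := singularHomology.coeffChange (Motives.ComplexPoints X)
    (algebraMap ℤ ℝ : ℤ →+* ℝ).toAddMonoidHom (2 * 2) μ.fundamentalClass with hFX
  set B : singularCohomology ℝ ℝ (Motives.ComplexPoints X) 2 →ₗ[ℝ]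
      singularCohomology ℝ ℝ (Motives.ComplexPoints X) 2 →ₗ[ℝ] ℝ :=
    (cupProduct h22).compr₂ ((kroneckerPairing ℝ ℝ (Motives.ComplexPoints X) (2 * 2)).flip FX) with hBdef
  have hB : ∀ x y, B x y = kroneckerPairing ℝ ℝ (Motives.ComplexPoints X) (2 * 2) (cupProduct h22 x y) FX :=
    fun x y ↦ by rw [hBdef, LinearMap.compr₂_apply, LinearMap.flip_apply]
  have hBsymm : ∀ x y, B x y = B y x := fun x y ↦ by
    rw [hB, hB, cupProduct_gradedComm_holds ℝ (Motives.ComplexPoints X) h22 h22 y x]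
    norm_num
  set yΩ := reClass (Motives.ComplexPoints X) (2 * 2) D.topClass with hyΩ
  set κ := reClass (Motives.ComplexPoints X) 2 D.Hη with hκ
  set P := kroneckerPairing ℝ ℝ (Motives.ComplexPoints X) (2 * 2) yΩ FX with hPdef
  have hdet : ∀ z : singularCohomology ℝ ℝ (Motives.ComplexPoints X) (2 * 2),
      kroneckerPairing ℝ ℝ (Motives.ComplexPoints X) (2 * 2) z FX = 0 → z = 0 := fun z hz ↦
    Literature.Geometry.Manifold.eq_zero_of_kroneckerPairing_coeffChange_fundamentalClass_eq_zero ℝ μ hz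
  have hκκ : B κ κ = P := by rw [hB, D.cupProduct_reClass_Hη h22]
  -- the restricted form is the form of the restricted pairing
  have hres : ∀ a b : U, LinearMap.BilinForm.restrict B U a b = B a b := fun a b ↦ rfl
  have hQ : (LinearMap.BilinMap.toQuadraticMap B).restrict U =
      LinearMap.BilinMap.toQuadraticMap (LinearMap.BilinForm.restrict B U) := by
    ext x
    rw [QuadraticMap.restrict_apply, LinearMap.BilinMap.toQuadraticMap_apply,
      LinearMap.BilinMap.toQuadraticMap_apply, hres]
  rw [hQ]
  -- the Kähler line `ℝ κ ⊆ U`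
  have hκU : κ ∈ U := (hU κ).2 (by rw [hκ, D.ofRealClass_reClass_Hη]; exact D.isOfHodgeType_Hη)
  have hκ0 : κ ≠ 0 := by
    intro h
    rw [h, LinearMap.map_zero₂] at hκκ
    exact hP.ne' hκκ.symm
  let f : ℝ →ₗ[ℝ] U := LinearMap.toSpanSingleton ℝ U ⟨κ, hκU⟩
  have hf : ∀ c : ℝ, f c = c • (⟨κ, hκU⟩ : U) := fun c ↦ rfl
  have hfinj : Function.Injective f := by
    intro a b hab
    rw [hf, hf] at hab
    have h := congrArg (fun u : U ↦ (u : singularCohomology ℝ ℝ (Motives.ComplexPoints X) 2)) hab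
    simp only [Submodule.coe_smul] at h
    by_contra hne
    have h' : (a - b) • κ = 0 := by rw [sub_smul, h, sub_self]
    exact hκ0 ((smul_eq_zero.1 h').resolve_left (sub_ne_zero.2 hne))
  have hpos : ∀ c : ℝ, c ≠ 0 → 0 < LinearMap.BilinForm.restrict B U (f c) (f c) := by
    intro c hc
    rw [hres, hf, Submodule.coe_smul]
    change 0 < B (c • κ) (c • κ)
    rw [LinearMap.map_smul₂, map_smul, smul_eq_mul, smul_eq_mul, hκκ, ← mul_assoc]
    exact mul_pos (mul_self_pos.2 hc) hP
  have hneg : ∀ y : U, (∀ c : ℝ, LinearMap.BilinForm.restrict B U (f c) y = 0) → y ≠ 0 →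
      LinearMap.BilinForm.restrict B U y y < 0 := by
    intro y hy hy0
    have hy0' : (y : singularCohomology ℝ ℝ (Motives.ComplexPoints X) 2) ≠ 0 := fun h ↦ hy0 (Subtype.ext h)
    have hκy : B κ y = 0 := by
      have := hy 1
      rwa [hres, hf, one_smul] at this
    have hprim : cupProduct (rfl : 2 + 2 = 2 + 2) D.Hη (ofRealClass _ 2 y) = 0 := by
      rw [← D.ofRealClass_reClass_Hη, ← ofRealClass_cupProduct]
      have h0 : cupProduct (rfl : 2 + 2 = 2 + 2) κ y = 0 := hdet _ (by rw [← hB]; exact hκy)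
      rw [h0, map_zero]
    have hy11 : IsOfHodgeType 2 X 2 1 1 (ofRealClass _ 2 y) := (hU y).1 y.2
    have hy0'' : ofRealClass _ 2 (y : singularCohomology ℝ ℝ (Motives.ComplexPoints X) 2) ≠ 0 :=
      fun h ↦ hy0' (ofRealClass_injective 2 (by rw [h, map_zero]))
    obtain ⟨t, ht, hEq⟩ := D.cupProduct_conjClass_oneOne hX hy11 hy0'' hprim h22
    rw [conjClass_ofRealClass, ← ofRealClass_cupProduct, ← D.ofRealClass_reClass_topClass, ← hyΩ,
      ← Complex.ofReal_neg, ← ofRealClass_smul] at hEq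
    have hyy : cupProduct h22 (y : singularCohomology ℝ ℝ _ 2) y = (-t) • yΩ := ofRealClass_injective (2 * 2) hEq
    rw [hres, hB, hyy, LinearMap.map_smul₂, smul_eq_mul]
    exact mul_neg_of_neg_of_pos (neg_neg_of_pos ht) hP
  obtain ⟨h1, h2⟩ := Literature.LinearAlgebra.QuadraticForm.sigPos_sigNeg_of_posDef_range
    (LinearMap.BilinForm.restrict B U) f hfinj hpos hneg
  rw [Module.finrank_self] at h1 h2
  exact ⟨h1, h2⟩

/-- **Signature `(1, h^{1,1} - 1)` on `H^{1,1}_ℝ`** (Huybrechts Cor. 3.3.16, second clause, with the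
orientation made explicit): `b⁺ = 1` and `b⁻ + 1 = h^{1,1}`, `h^{1,1}` the dimension of the type piece
`(1,1)` of any Hodge model. [cite: Huybrechts2005, Cor. 3.3.16] [cite: VoisinHodgeI2002, §6.3.2 Thm. 6.32] -/
theorem sigPos_sigNeg_restrict_oneOne_eq_hodgeNumber (hX : IsSmoothProjective 2 X)
    (μ : HomologicalOrientation ℤ (Motives.ComplexPoints X) (2 * 2)) (h22 : 2 + 2 = 2 * 2)
    (hP : 0 < kroneckerPairing ℝ ℝ (Motives.ComplexPoints X) (2 * 2) (reClass _ (2 * 2) D.topClass)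
      (singularHomology.coeffChange (Motives.ComplexPoints X)
        (algebraMap ℤ ℝ : ℤ →+* ℝ).toAddMonoidHom (2 * 2) μ.fundamentalClass))
    (U : Submodule ℝ (singularCohomology ℝ ℝ (Motives.ComplexPoints X) 2))
    (hU : ∀ y, y ∈ U ↔ IsOfHodgeType 2 X 2 1 1 (ofRealClass _ 2 y)) (A : HodgeModel 2 X) :
    sigPos ((LinearMap.BilinMap.toQuadraticMap
        ((cupProduct (R := ℝ) (X := Motives.ComplexPoints X) h22).compr₂
          ((kroneckerPairing ℝ ℝ (Motives.ComplexPoints X) (2 * 2)).flip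
            (singularHomology.coeffChange (Motives.ComplexPoints X)
              (algebraMap ℤ ℝ : ℤ →+* ℝ).toAddMonoidHom (2 * 2) μ.fundamentalClass)))).restrict U) = 1 ∧
      sigNeg ((LinearMap.BilinMap.toQuadraticMap
        ((cupProduct (R := ℝ) (X := Motives.ComplexPoints X) h22).compr₂
          ((kroneckerPairing ℝ ℝ (Motives.ComplexPoints X) (2 * 2)).flip
            (singularHomology.coeffChange (Motives.ComplexPoints X)
              (algebraMap ℤ ℝ : ℤ →+* ℝ).toAddMonoidHom (2 * 2) μ.fundamentalClass)))).restrict U) + 1 =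
        Module.finrank ℂ (A.typePiece 2 ⟨(1, 1), Finset.HasAntidiagonal.mem_antidiagonal.2 rfl⟩) := by
  rw [← finrank_realOneOne_eq hX U hU A]
  exact D.sigPos_sigNeg_restrict_oneOne_of_pos hX μ h22 hP U hU

end KaehlerRationalDatum

end Surface

end Literature.AlgebraicGeometry.HodgeTheory

end
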